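import Mathlib
import Summits.Ventures.PercRepro2.K5HyperTheoremI
import Summits.Ventures.PercRepro2.K5HyperCertMI1
import Summits.Ventures.PercRepro2.K5HyperCertMI2
import Summits.Ventures.PercRepro2.K5HyperCertMI3
import Summits.Ventures.PercRepro2.K5HyperCertMI4
import Summits.Ventures.PercRepro2.K5HyperCertMI5
import Summits.Ventures.PercRepro2.K5HyperCertTvTIA
import Summits.Ventures.PercRepro2.K5HyperCertTvTIB
import Summits.Ventures.PercRepro2.K5HyperCertTvTIC
import Summits.Ventures.PercRepro2.K5HyperCertT1I
import Summits.Ventures.PercRepro2.K5HyperCertT2I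

/-!
# THE 60 (i)-SIDE STAR STATEMENTS OF mine-1 §23.5 AT EVERY `K₅` PROFILE, IN THE KERNEL
(blind cell PercRepro2, typer-1 g10)

The kernel certificates `K5HyperCertMI*.lean` / `K5HyperCertTvTI*.lean` / `K5HyperCertT1I.lean` /
`K5HyperCertT2I.lean` collected over all triangles `T = {a, b, c}` of marks (`certTvTI`, `certMI`, `certT1I`,
`certT2I`), through `K5HyperCoeffsI.lean` and the dictionary `K5HyperTheoremI.lean`:

* **`TvTI_nonneg_real`**: `N⁽ⁱ⁾(H + T(1)) ≤ N⁽ⁱ⁾(H + △(1,1,1))` — `TvT-(i) ≥ 0`;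
* **`MI_nonneg_real`**: `N⁽ⁱ⁾(H + T(1)) ≤ N⁽ⁱ⁾(H + T(1) + e(1))` — `M-(i) ≥ 0`;
* **`T1I_nonneg_real`**, **`T2I_nonneg_real`**: `0 ≤ N⁽ⁱ⁾(H + T(1))`, `0 ≤ N⁽ⁱ⁾(H + T(2))` —

as profile sums of p1's `KI`, every triangle of marks, every pair, every profile (any ordered field).
-/

namespace Summit.Ventures.PercRepro2

namespace K5

/-- **The `TvT-(i)` certificate of every triangle of marks.** -/
theorem certTvTI (a b c : ℕ) (hab : a < b) (hbc : b < c) (hc : c < 5) :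
    CertLE (kNegTvTI a b c) (kPosTvTI a b c) := by
  interval_cases c <;> interval_cases b <;> interval_cases a
  · exact cert_TvTI_012
  · exact cert_TvTI_013
  · exact cert_TvTI_023
  · exact cert_TvTI_123
  · exact cert_TvTI_014
  · exact cert_TvTI_024
  · exact cert_TvTI_124
  · exact cert_TvTI_034
  · exact cert_TvTI_134
  · exact cert_TvTI_234

/-- **The `N⁽ⁱ⁾(H + T(1)) ≥ 0` certificate of every triangle of marks.** -/
theorem certT1I (a b c : ℕ) (hab : a < b) (hbc : b < c) (hc : c < 5) :
    CertLE (sumT1 posOnI (triMask a b c)) (sumT1 negOnI (triMask a b c)) := by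
  interval_cases c <;> interval_cases b <;> interval_cases a
  · exact cert_T1I_012
  · exact cert_T1I_013
  · exact cert_T1I_023
  · exact cert_T1I_123
  · exact cert_T1I_014
  · exact cert_T1I_024
  · exact cert_T1I_124
  · exact cert_T1I_034
  · exact cert_T1I_134
  · exact cert_T1I_234

/-- **The `N⁽ⁱ⁾(H + T(2)) ≥ 0` certificate of every triangle of marks.** -/
theorem certT2I (a b c : ℕ) (hab : a < b) (hbc : b < c) (hc : c < 5) :
    CertLE (sumT2 posOnI (triMask a b c)) (sumT2 negOnI (triMask a b c)) := by
  interval_cases c <;> interval_cases b <;> interval_cases a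
  · exact cert_T2I_012
  · exact cert_T2I_013
  · exact cert_T2I_023
  · exact cert_T2I_123
  · exact cert_T2I_014
  · exact cert_T2I_024
  · exact cert_T2I_124
  · exact cert_T2I_034
  · exact cert_T2I_134
  · exact cert_T2I_234

/-- **The `M-(i)` certificate of every triangle of marks and every pair of it.** -/
theorem certMI (a b c x y : ℕ) (hab : a < b) (hbc : b < c) (hc : c < 5)
    (hxy : (x = a ∧ y = b) ∨ (x = a ∧ y = c) ∨ (x = b ∧ y = c)) :
    CertLE (kNegMI (triMask a b c) (pairMask x y)) (kPosMI (triMask a b c) (pairMask x y)) := by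
  interval_cases c <;> interval_cases b <;> interval_cases a <;>
    rcases hxy with ⟨rfl, rfl⟩ | ⟨rfl, rfl⟩ | ⟨rfl, rfl⟩
  · exact cert_MI_012_01
  · exact cert_MI_012_02
  · exact cert_MI_012_12
  · exact cert_MI_013_01
  · exact cert_MI_013_03
  · exact cert_MI_013_13
  · exact cert_MI_023_02
  · exact cert_MI_023_03
  · exact cert_MI_023_23
  · exact cert_MI_123_12
  · exact cert_MI_123_13
  · exact cert_MI_123_23
  · exact cert_MI_014_01
  · exact cert_MI_014_04
  · exact cert_MI_014_14
  · exact cert_MI_024_02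
  · exact cert_MI_024_04
  · exact cert_MI_024_24
  · exact cert_MI_124_12
  · exact cert_MI_124_14
  · exact cert_MI_124_24
  · exact cert_MI_034_03
  · exact cert_MI_034_04
  · exact cert_MI_034_34
  · exact cert_MI_134_13
  · exact cert_MI_134_14
  · exact cert_MI_134_34
  · exact cert_MI_234_23
  · exact cert_MI_234_24
  · exact cert_MI_234_34

variable {R : Type*} [Field R] [LinearOrder R] [IsStrictOrderedRing R]

/-- **`TvT-(i) ≥ 0`** as profile sums of `KI`, every triangle, every profile. -/
theorem TvTI_nonneg_real (a b c : ℕ) (hab : a < b) (hbc : b < c) (hc : c < 5) (k : Fin 10 → Fin 4) :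
    NT1I (R := R) (triMask a b c) k ≤ NE3I (R := R) (pairMask a b) (pairMask a c) (pairMask b c) k :=
  TvTI_real a b c (certTvTI a b c hab hbc hc) k

/-- **`M-(i) ≥ 0`** as profile sums of `KI`, every triangle, every pair of it, every profile. -/
theorem MI_nonneg_real (a b c x y : ℕ) (hab : a < b) (hbc : b < c) (hc : c < 5)
    (hxy : (x = a ∧ y = b) ∨ (x = a ∧ y = c) ∨ (x = b ∧ y = c)) (k : Fin 10 → Fin 4) :
    NT1I (R := R) (triMask a b c) k ≤ NT1e1I (R := R) (triMask a b c) (pairMask x y) k :=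
  MI_real _ _ (certMI a b c x y hab hbc hc hxy) k

/-- **`0 ≤ N⁽ⁱ⁾(H + T(1))`** as a profile sum of `KI`, every triangle, every profile. -/
theorem T1I_nonneg_real (a b c : ℕ) (hab : a < b) (hbc : b < c) (hc : c < 5) (k : Fin 10 → Fin 4) :
    0 ≤ NT1I (R := R) (triMask a b c) k :=
  T1I_real _ (certT1I a b c hab hbc hc) k

/-- **`0 ≤ N⁽ⁱ⁾(H + T(2))`** as a profile sum of `KI`, every triangle, every profile. -/
theorem T2I_nonneg_real (a b c : ℕ) (hab : a < b) (hbc : b < c) (hc : c < 5) (k : Fin 10 → Fin 4) :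
    0 ≤ NT2I (R := R) (triMask a b c) k :=
  T2I_real _ (certT2I a b c hab hbc hc) k

end K5

end Summit.Ventures.PercRepro2
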